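import Mathlib.RingTheory.Localization.Module
import Mathlib.Data.Nat.Factorization.Induction
import Mathlib.GroupTheory.QuotientGroup.Basic
import Literature.NumberTheory.DiophantineApproximation.KroneckerTheorem
import Summits.KontsevichZagierPeriods.KontsevichZagierPeriods.Theorems.HurwitzMicroSectorsNormalFormPrincipleDlogMoves

/-!
# `NormalFormPrinciple` (stmt-KontsevichZagierPeriods-3869), line `SketchIdeator1` — the dlog
# layer of the leaf `stub_boxRigidity`: a vanishing `ℤ`-combination of dlog representations is a
# relation (`dlog_sum_mem_relations`, registered sub-goal; siege k1, Mathlib API route)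

Pure proof file (`--supports` the crux stmt-KontsevichZagierPeriods-3869). It proves the registered
sub-goal `dlog_sum_mem_relations` — Conjecture 1 of Kontsevich–Zagier in kernel form for the dlog
family over `ℚ`:

  for `Lᵢ = [(aᵢ, bᵢ), cᵢ/y]` (`0 < aᵢ < bᵢ`, `aᵢ, bᵢ, cᵢ ∈ ℚ`, `nᵢ ∈ ℤ`),
  `eval (Σ nᵢ • [Lᵢ]) = 0 ⟹ Σ nᵢ • [Lᵢ] ∈ KZ.relations`.

The argument runs in the quotient group `FormalRep ⧸ relations` with Mathlib's bundled API
(`QuotientAddGroup.mk'`, `AddMonoidHom.mk'`, `map_sum`/`map_zsmul`, `Nat.factorization`,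
`LinearIndependent.iff_fractionRing`), on top of the four moves of
`HurwitzMicroSectorsNormalFormPrincipleDlogMoves.lean` (scaling, splitting, merging, empty slab):

1. **carriers** `Λ(N, c) := [(1, N), c/y]` (`N : ℕ`): `[(a,b), c/y] ≡ Λ(B,c) − Λ(A,c)` for
   `b/a = B/A` (one scaling, one splitting); `Λ(MN,c) ≡ Λ(M,c) + Λ(N,c)` (one splitting, one
   scaling), whence `Λ(N,c) ≡ Σ_p v_p(N) • Λ(p,c)` (`induction_on_primes`);
2. **coefficients**: `c ↦ [Λ(p,c)]` is additive (merging), so it is an additive monoid hom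
   `ℚ →+ FormalRep ⧸ relations`, and `Σ mᵢ • [Λ(p,cᵢ)] = [Λ(p, Σ mᵢcᵢ)]`;
3. **values**: soundness of the calculus (`relations_le_ker_eval_holds`) turns the formal identity
   `Σ nᵢ•[Lᵢ] ≡ Σ_p Σᵢ (nᵢ e_{ip}) • [Λ(p,cᵢ)]` into `0 = Σ_p (Σᵢ nᵢ e_{ip} cᵢ) log p`, and the
   `ℚ`-linear independence of the `log p` (unique factorisation, tree:
   `Kronecker.linearIndependent_log_of_prime`, upgraded from `ℤ` to `ℚ` by
   `LinearIndependent.iff_fractionRing`) kills every coefficient `Σᵢ nᵢ e_{ip} cᵢ`;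
4. by (2) every `p`-block is then `[Λ(p, 0)] = 0`, so the whole combination is a relation.

The only arithmetic input is unique factorisation; no transcendence statement is used.
Sources: M. Kontsevich, D. Zagier, *Periods* (2001), §1.1–§1.2. No definitions are introduced
(the carrier family is quantified, `exists_carrier_family`). Everything lives in the namespace
`…NormalFormPrinciple.PiBox.Dlog.K1` (siege attempt k1). A sibling proof of the same registered
statement, `…PiBox.Dlog.K8.dlog_sum_mem_relations` (`…DlogLatticeK8.lean`), closes the endgame
with Hermite–Lindemann (`eq_zero_of_rat_add_sum_mul_log_prime_eq_zero` of `…SplitAlgebra.lean`);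
the present file is independent of it and of `…SplitAlgebra.lean`, its endgame being the
`ℤ`-independence of the `log p` alone.
-/

noncomputable section

open MeasureTheory Set Finset
open Literature.NumberTheory.Transcendental Literature.NumberTheory.Transcendental.KZ

namespace Summit.KontsevichZagierPeriods.HurwitzMicroSectors.NormalFormPrinciple.PiBox

namespace Dlog

namespace K1

/-! ## The carriers `Λ(N, c) = [(1, N), c/y]` -/

/-- **A family of carriers exists**: representations `R N c = [(1, N), c/y]` for all `N : ℕ`,
`c : ℚ` (domain the slab `{1 < y < N} ⊂ ℝ¹`, integrand `c/y`). [cite: KontsevichZagier2001, §1.1] -/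
theorem exists_carrier_family :
    ∃ R : ℕ → ℚ → IntegralRep 1, ∀ N c, (R N c).domain = {x | x 0 ∈ Set.Ioo (1:ℝ) N} ∧
      (R N c).integrand = fun x => (c:ℝ) / x 0 := by
  refine ⟨fun N c => (exists_dlog 1 N c one_pos).choose, fun N c => ?_⟩
  obtain ⟨h1, h2⟩ := (exists_dlog 1 (N:ℚ) c one_pos).choose_spec
  refine ⟨?_, h2⟩
  rw [h1, Rat.cast_one, Rat.cast_natCast]

section Carriers

variable {R : ℕ → ℚ → IntegralRep 1}

/-- The domain of a carrier with rational-cast endpoints (the shape the move lemmas of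
`…DlogMoves.lean` expect). [folklore] -/
theorem carrier_domain_rat
    (hR : ∀ N c, (R N c).domain = {x | x 0 ∈ Set.Ioo (1:ℝ) N} ∧
      (R N c).integrand = fun x => (c:ℝ) / x 0)
    (N : ℕ) (c : ℚ) : (R N c).domain = {x | x 0 ∈ Set.Ioo ((1:ℚ):ℝ) ((N:ℚ):ℝ)} := by
  rw [(hR N c).1, Rat.cast_one, Rat.cast_natCast]

/-- **The unit carrier is a relation**: `[(1,1), c/y]` has empty domain.
[cite: KontsevichZagier2001, §1.2 rule (1)] -/
theorem carrier_one_mem_relations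
    (hR : ∀ N c, (R N c).domain = {x | x 0 ∈ Set.Ioo (1:ℝ) N} ∧
      (R N c).integrand = fun x => (c:ℝ) / x 0)
    (c : ℚ) : of (R 1 c) ∈ relations :=
  slab_empty_mem_relations (R 1 c) (hR 1 c).1 (by norm_num)

/-- **Multiplicativity of the carriers**: `Λ(MN, c) − Λ(M, c) − Λ(N, c) ∈ relations` for
`1 ≤ M, N` — split `(1, MN)` at `M` and rescale `(M, MN)` to `(1, N)` by `y ↦ M y`.
[cite: KontsevichZagier2001, §1.2 rules (1), (2)] -/
theorem carrier_mul_mem_relations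
    (hR : ∀ N c, (R N c).domain = {x | x 0 ∈ Set.Ioo (1:ℝ) N} ∧
      (R N c).integrand = fun x => (c:ℝ) / x 0)
    (c : ℚ) {M N : ℕ} (hM : 1 ≤ M) (hN : 1 ≤ N) :
    of (R (M * N) c) - of (R M c) - of (R N c) ∈ relations := by
  have hM0 : (0:ℚ) < M := by exact_mod_cast hM
  -- the middle piece `[(M, MN), c/y]`
  obtain ⟨T, hTd, hTi⟩ := exists_dlog (M:ℚ) ((M:ℚ) * N) c hM0
  -- scaling `[(1, N), c/y] ≡ [(M, MN), c/y]`
  have hscale : of (R N c) - of T ∈ relations := by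
    refine dlog_scale_mem_relations (a := 1) (b := (N:ℚ)) (c := c) (s := (M:ℚ)) (R N c) T
      (carrier_domain_rat hR N c) ?_ ?_ ?_ one_pos hM0
    · rw [hTd, mul_one]
    · rw [(hR N c).2]
      exact fun x _ => rfl
    · rw [hTi]
      exact fun x _ => rfl
  -- splitting `[(1, MN)] ≡ [(1, M)] + [(M, MN)]`
  have hsplit : of (R (M * N) c) - of (R M c) - of T ∈ relations := by
    refine split_mem_relations (a := (1:ℝ)) (b := (M:ℝ)) (b' := (M:ℝ) * N) (R (M * N) c) (R M c) T
      ?_ (hR M c).1 ?_ (by exact_mod_cast hM) ?_ ?_ ?_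
    · rw [(hR (M * N) c).1, Nat.cast_mul]
    · rw [hTd, Rat.cast_mul, Rat.cast_natCast, Rat.cast_natCast]
    · have hN' : (1:ℝ) ≤ N := by exact_mod_cast hN
      have hM' : (0:ℝ) ≤ M := by exact_mod_cast (Nat.zero_le M)
      nlinarith
    · rw [(hR M c).2, (hR (M * N) c).2]
      exact fun x _ => rfl
    · rw [hTi, (hR (M * N) c).2]
      exact fun x _ => rfl
  have : of (R (M * N) c) - of (R M c) - of (R N c) =
      (of (R (M * N) c) - of (R M c) - of T) - (of (R N c) - of T) := by abel
  rw [this]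
  exact relations.sub_mem hsplit hscale

/-- **Additivity of the carriers in the coefficient** (merging):
`Λ(N, c + c') − Λ(N, c) − Λ(N, c') ∈ relations`. [cite: KontsevichZagier2001, §1.2 rule (1)] -/
theorem carrier_add_mem_relations
    (hR : ∀ N c, (R N c).domain = {x | x 0 ∈ Set.Ioo (1:ℝ) N} ∧
      (R N c).integrand = fun x => (c:ℝ) / x 0)
    (N : ℕ) (c c' : ℚ) : of (R N (c + c')) - of (R N c) - of (R N c') ∈ relations :=
  dlog_merge_mem_relations (σ := {x | x 0 ∈ Set.Ioo (1:ℝ) N}) (R N (c + c')) (R N c) (R N c')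
    (hR N (c + c')).1 (hR N c).1 (hR N c').1
    (by rw [(hR N (c + c')).2]; exact fun x _ => rfl)
    (by rw [(hR N c).2]; exact fun x _ => rfl)
    (by rw [(hR N c').2]; exact fun x _ => rfl)

/-- **The coefficient map is an additive monoid hom** `ℚ →+ FormalRep ⧸ relations`,
`c ↦ [Λ(N, c)]` (bundled form of `carrier_add_mem_relations`). [folklore] -/
theorem exists_carrierHom
    (hR : ∀ N c, (R N c).domain = {x | x 0 ∈ Set.Ioo (1:ℝ) N} ∧
      (R N c).integrand = fun x => (c:ℝ) / x 0)
    (N : ℕ) : ∃ φ : ℚ →+ FormalRep ⧸ relations,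
      ∀ c, φ c = QuotientAddGroup.mk' relations (of (R N c)) := by
  refine ⟨AddMonoidHom.mk' (fun c => QuotientAddGroup.mk' relations (of (R N c))) fun c c' => ?_,
    fun c => rfl⟩
  rw [← map_add, QuotientAddGroup.mk'_apply, QuotientAddGroup.mk'_apply,
    QuotientAddGroup.eq_iff_sub_mem, ← sub_sub]
  exact carrier_add_mem_relations hR N c c'

/-- **Linearity in the coefficient**: if `Σᵢ mᵢ cᵢ = 0` (`mᵢ ∈ ℤ`, `cᵢ ∈ ℚ`) then
`Σᵢ mᵢ • [Λ(N, cᵢ)] = [Λ(N, Σ mᵢ cᵢ)] = [Λ(N, 0)] = 0` in `FormalRep ⧸ relations`. [folklore] -/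
theorem sum_zsmul_carrier_eq_zero
    (hR : ∀ N c, (R N c).domain = {x | x 0 ∈ Set.Ioo (1:ℝ) N} ∧
      (R N c).integrand = fun x => (c:ℝ) / x 0)
    (N : ℕ) {ι : Type*} (s : Finset ι) (m : ι → ℤ) (c : ι → ℚ)
    (h : ∑ i ∈ s, (m i : ℚ) * c i = 0) :
    QuotientAddGroup.mk' relations (∑ i ∈ s, m i • of (R N (c i))) = 0 := by
  obtain ⟨φ, hφ⟩ := exists_carrierHom hR N
  calc QuotientAddGroup.mk' relations (∑ i ∈ s, m i • of (R N (c i)))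
      = ∑ i ∈ s, m i • φ (c i) := by simp only [map_sum, map_zsmul, hφ]
    _ = φ (∑ i ∈ s, m i • c i) := by simp only [map_sum, map_zsmul]
    _ = 0 := by
        have : ∑ i ∈ s, m i • c i = ∑ i ∈ s, (m i : ℚ) * c i :=
          Finset.sum_congr rfl fun i _ => zsmul_eq_mul (c i) (m i)
        rw [this, h, map_zero]

/-- **Prime decomposition of the carriers**: for `N ≠ 0` with prime factors in `S`,
`[Λ(N, c)] = Σ_{p ∈ S} v_p(N) • [Λ(p, c)]` in `FormalRep ⧸ relations` (multiplicativity and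
`induction_on_primes`). [folklore] -/
theorem carrier_eq_sum_factorization
    (hR : ∀ N c, (R N c).domain = {x | x 0 ∈ Set.Ioo (1:ℝ) N} ∧
      (R N c).integrand = fun x => (c:ℝ) / x 0)
    (c : ℚ) (S : Finset ℕ) :
    ∀ N : ℕ, N ≠ 0 → N.primeFactors ⊆ S →
      QuotientAddGroup.mk' relations (of (R N c)) =
        ∑ p ∈ S, (N.factorization p : ℤ) • QuotientAddGroup.mk' relations (of (R p c)) := by
  refine induction_on_primes ?_ ?_ ?_
  · intro h
    exact absurd rfl h
  · intro _ _
    rw [Nat.factorization_one]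
    simp only [Finsupp.coe_zero, Pi.zero_apply, Nat.cast_zero, zero_zsmul, Finset.sum_const_zero]
    exact (QuotientAddGroup.eq_zero_iff _).mpr (carrier_one_mem_relations hR c)
  · intro p a hp ih hpa hS
    have ha0 : a ≠ 0 := fun h => hpa (by rw [h, mul_zero])
    have hpS : p ∈ S := hS (Nat.mem_primeFactors.mpr ⟨hp, dvd_mul_right p a, hpa⟩)
    have haS : a.primeFactors ⊆ S := fun q hq => hS (by
      rw [Nat.primeFactors_mul hp.ne_zero ha0]
      exact Finset.mem_union_right _ hq)
    rw [Nat.factorization_mul hp.ne_zero ha0, hp.factorization]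
    simp only [Finsupp.coe_add, Pi.add_apply, Nat.cast_add, add_zsmul, Finset.sum_add_distrib]
    rw [← ih ha0 haS, Finset.sum_eq_single p, Finsupp.single_eq_same, Nat.cast_one, one_zsmul]
    · rw [← map_add, QuotientAddGroup.mk'_apply, QuotientAddGroup.mk'_apply,
        QuotientAddGroup.eq_iff_sub_mem, ← sub_sub]
      exact carrier_mul_mem_relations hR c hp.one_lt.le (Nat.one_le_iff_ne_zero.mpr ha0)
    · intro q _ hqp
      rw [Finsupp.single_eq_of_ne hqp, Nat.cast_zero, zero_zsmul]
    · intro hp'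
      exact absurd hpS hp'

/-- **A dlog representation on the carriers**: for `0 < a < b` with `b · A = a · B`
(`1 ≤ A ≤ B` naturals), `[(a,b), c/y] = [Λ(B, c)] − [Λ(A, c)]` in `FormalRep ⧸ relations`
(rescale by `A/a` onto `(A, B)`, then split `(1, B)` at `A`).
[cite: KontsevichZagier2001, §1.2 rules (1), (2)] -/
theorem rep_eq_carrier_sub
    (hR : ∀ N c, (R N c).domain = {x | x 0 ∈ Set.Ioo (1:ℝ) N} ∧
      (R N c).integrand = fun x => (c:ℝ) / x 0)
    {a b c : ℚ} (ha : 0 < a) (L : IntegralRep 1)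
    (hd : L.domain = {x | x 0 ∈ Set.Ioo (a:ℝ) b})
    (hi : EqOn L.integrand (fun x => (c:ℝ) / x 0) L.domain)
    {A B : ℕ} (hA : 1 ≤ A) (hAB : A ≤ B) (hq : b * A = a * B) :
    QuotientAddGroup.mk' relations (of L) =
      QuotientAddGroup.mk' relations (of (R B c)) - QuotientAddGroup.mk' relations (of (R A c)) := by
  have hA0 : (0:ℚ) < A := by exact_mod_cast hA
  obtain ⟨T, hTd, hTi⟩ := exists_dlog (A:ℚ) (B:ℚ) c hA0
  have hs : 0 < (A:ℚ) / a := div_pos hA0 ha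
  -- scaling `[(a, b)] ≡ [(A, B)]`
  have hscale : of L - of T ∈ relations := by
    refine dlog_scale_mem_relations (s := (A:ℚ) / a) L T hd ?_ hi
      (by rw [hTi]; exact fun x _ => rfl) ha hs
    have h1 : (A:ℚ) / a * a = A := div_mul_cancel₀ _ ha.ne'
    have h2 : (A:ℚ) / a * b = B := by
      rw [div_mul_eq_mul_div, div_eq_iff ha.ne']
      linear_combination hq
    rw [hTd, h1, h2]
  -- splitting `[(1, B)] ≡ [(1, A)] + [(A, B)]`
  have hsplit : of (R B c) - of (R A c) - of T ∈ relations := by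
    refine split_mem_relations (a := (1:ℝ)) (b := (A:ℝ)) (b' := (B:ℝ)) (R B c) (R A c) T
      (hR B c).1 (hR A c).1 ?_ (by exact_mod_cast hA) (by exact_mod_cast hAB) ?_ ?_
    · rw [hTd, Rat.cast_natCast, Rat.cast_natCast]
    · rw [(hR A c).2, (hR B c).2]
      exact fun _ _ => rfl
    · rw [hTi, (hR B c).2]
      exact fun _ _ => rfl
  rw [← map_sub, QuotientAddGroup.mk'_apply, QuotientAddGroup.mk'_apply,
    QuotientAddGroup.eq_iff_sub_mem]
  have : of L - (of (R B c) - of (R A c)) =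
      (of L - of T) - (of (R B c) - of (R A c) - of T) := by abel
  rw [this]
  exact relations.sub_mem hscale hsplit

end Carriers

/-! ## Arithmetic -/

/-- **Integral form of a ratio of positive rationals**: for `0 < a < b` there are naturals
`1 ≤ A ≤ B`, `B ≠ 0`, with `b · A = a · B` (namely `B/A = b/a` in lowest terms). [folklore] -/
theorem exists_nat_ratio {a b : ℚ} (ha : 0 < a) (hab : a < b) :
    ∃ A B : ℕ, 1 ≤ A ∧ A ≤ B ∧ B ≠ 0 ∧ b * A = a * B := by
  set q : ℚ := b / a with hq
  have hq0 : 0 < q := div_pos (ha.trans hab) ha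
  have hnum : 0 < q.num := Rat.num_pos.mpr hq0
  have hB : ((q.num.natAbs : ℕ) : ℚ) = q.num := by rw [Nat.cast_natAbs, abs_of_nonneg hnum.le]
  have hA0 : (0:ℚ) < q.den := by exact_mod_cast q.den_pos
  have hBA : b * q.den = a * q.num.natAbs := by
    have h := Rat.num_div_den q
    rw [← hB, hq, div_eq_div_iff hA0.ne' ha.ne'] at h
    linear_combination -h
  refine ⟨q.den, q.num.natAbs, q.den_pos, ?_, Int.natAbs_ne_zero.mpr hnum.ne', hBA⟩
  have hlt : a * q.den < a * q.num.natAbs := by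
    rw [← hBA]
    exact mul_lt_mul_of_pos_right hab hA0
  exact_mod_cast (lt_of_mul_lt_mul_left hlt ha.le).le

/-- **The logarithms of the primes are linearly independent over `ℚ`** (unique factorisation;
tree `Kronecker.linearIndependent_log_of_prime` over `ℤ`, and `ℤ → ℚ` by
`LinearIndependent.iff_fractionRing`): a vanishing rational combination `Σ_{p ∈ S} C_p log p = 0`
has all `C_p = 0`. [folklore] -/
theorem eq_zero_of_sum_rat_mul_log_prime_eq_zero {S : Finset ℕ} (hS : ∀ p ∈ S, p.Prime)
    (C : ℕ → ℚ) (h : ∑ p ∈ S, (C p : ℝ) * Real.log p = 0) : ∀ p ∈ S, C p = 0 := by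
  classical
  have hQ : LinearIndependent ℚ (fun p : S => Real.log (p : ℕ)) :=
    (LinearIndependent.iff_fractionRing ℤ ℚ).mp
      (Literature.NumberTheory.DiophantineApproximation.Kronecker.linearIndependent_log_of_prime S hS)
  rw [Fintype.linearIndependent_iff] at hQ
  have h0 := hQ (fun p => C p) (by
    rw [← Finset.sum_coe_sort S] at h
    rw [← h]
    refine Finset.sum_congr rfl fun p _ => ?_
    rw [Rat.smul_def])
  exact fun p hp => h0 ⟨p, hp⟩

/-! ## The theorem -/

/-- **Conjecture 1 in kernel form for the dlog family over `ℚ`** (registered sub-goal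
`dlog_sum_mem_relations` of crux stmt-KontsevichZagierPeriods-3869, the lowest layer of the leaf
`stub_boxRigidity`): if `Lᵢ = [(aᵢ, bᵢ), cᵢ/y]` with rationals `0 < aᵢ < bᵢ`, `cᵢ`, and a
`ℤ`-combination `Σ nᵢ • [Lᵢ]` evaluates to `0`, then `Σ nᵢ • [Lᵢ]` is a relation of the KZ
calculus. Input: the moves (1a), (1b), (2) and unique factorisation only.
[cite: KontsevichZagier2001, §1.2 Conjecture 1] -/
theorem dlog_sum_mem_relations {k : ℕ} (n : Fin k → ℤ) (a b c : Fin k → ℚ)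
    (L : Fin k → IntegralRep 1) (ha : ∀ i, 0 < a i) (hab : ∀ i, a i < b i)
    (hd : ∀ i, (L i).domain = {x | x 0 ∈ Set.Ioo (a i : ℝ) (b i)})
    (hi : ∀ i, EqOn (L i).integrand (fun x => (c i : ℝ) / x 0) (L i).domain)
    (hv : eval (∑ i, n i • of (L i)) = 0) : ∑ i, n i • of (L i) ∈ relations := by
  classical
  obtain ⟨R, hR⟩ := exists_carrier_family
  -- integral data `bᵢ/aᵢ = Bᵢ/Aᵢ`, the primes involved, the exponents
  have hratio : ∀ i, ∃ A B : ℕ, 1 ≤ A ∧ A ≤ B ∧ B ≠ 0 ∧ b i * A = a i * B :=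
    fun i => exists_nat_ratio (ha i) (hab i)
  choose A B hA1 hAB hB0 hBA using hratio
  have hA0 : ∀ i, A i ≠ 0 := fun i => Nat.one_le_iff_ne_zero.mp (hA1 i)
  set S : Finset ℕ := Finset.univ.biUnion fun i => (A i).primeFactors ∪ (B i).primeFactors with hS_def
  have hS : ∀ p ∈ S, p.Prime := by
    intro p hp
    obtain ⟨i, -, hi'⟩ := Finset.mem_biUnion.mp hp
    rcases Finset.mem_union.mp hi' with h | h
    · exact Nat.prime_of_mem_primeFactors h
    · exact Nat.prime_of_mem_primeFactors h
  have hAS : ∀ i, (A i).primeFactors ⊆ S := fun i p hp =>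
    Finset.mem_biUnion.mpr ⟨i, Finset.mem_univ i, Finset.mem_union_left _ hp⟩
  have hBS : ∀ i, (B i).primeFactors ⊆ S := fun i p hp =>
    Finset.mem_biUnion.mpr ⟨i, Finset.mem_univ i, Finset.mem_union_right _ hp⟩
  obtain ⟨e, he⟩ : ∃ e : Fin k → ℕ → ℤ,
      ∀ i p, e i p = ((B i).factorization p : ℤ) - ((A i).factorization p : ℤ) :=
    ⟨_, fun _ _ => rfl⟩
  -- Step 1: each `[Lᵢ]` on the prime carriers
  have hdec : ∀ i, QuotientAddGroup.mk' relations (of (L i)) =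
      ∑ p ∈ S, e i p • QuotientAddGroup.mk' relations (of (R p (c i))) := by
    intro i
    rw [rep_eq_carrier_sub hR (ha i) (L i) (hd i) (hi i) (hA1 i) (hAB i) (hBA i),
      carrier_eq_sum_factorization hR (c i) S (B i) (hB0 i) (hBS i),
      carrier_eq_sum_factorization hR (c i) S (A i) (hA0 i) (hAS i), ← Finset.sum_sub_distrib]
    refine Finset.sum_congr rfl fun p _ => ?_
    rw [he, sub_zsmul, sub_eq_add_neg]
  -- Step 2: the whole combination on the prime carriers
  have hsum : QuotientAddGroup.mk' relations (∑ i, n i • of (L i)) =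
      ∑ p ∈ S, QuotientAddGroup.mk' relations (∑ i, (n i * e i p) • of (R p (c i))) := by
    simp only [map_sum, map_zsmul, hdec, Finset.smul_sum, smul_smul]
    exact Finset.sum_comm
  -- Step 3: values — the coefficient of `log p` is `C p = Σᵢ nᵢ e_{ip} cᵢ`
  have hval : ∀ p ∈ S, eval (∑ i, (n i * e i p) • of (R p (c i))) =
      ((∑ i, ((n i * e i p : ℤ) : ℚ) * c i : ℚ) : ℝ) * Real.log p := by
    intro p hp
    have hp1 : (1:ℚ) ≤ p := by exact_mod_cast (hS p hp).one_lt.le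
    have hRv : ∀ i, (R p (c i)).value = (c i : ℝ) * Real.log p := fun i => by
      rw [value_dlog (R p (c i)) (carrier_domain_rat hR p (c i))
        (by rw [(hR p (c i)).2]; exact fun _ _ => rfl) one_pos hp1,
        Rat.cast_one, Rat.cast_natCast, div_one]
    simp only [map_sum, map_zsmul, eval_of, hRv, zsmul_eq_mul]
    push_cast
    rw [Finset.sum_mul]
    exact Finset.sum_congr rfl fun i _ => by ring
  have hmem : ∑ i, n i • of (L i) - ∑ p ∈ S, ∑ i, (n i * e i p) • of (R p (c i)) ∈ relations := by
    have h := hsum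
    rw [← map_sum, QuotientAddGroup.mk'_apply, QuotientAddGroup.mk'_apply,
      QuotientAddGroup.eq_iff_sub_mem] at h
    exact h
  have hker := relations_le_ker_eval_holds hmem
  rw [AddMonoidHom.mem_ker, map_sub, hv, zero_sub, neg_eq_zero, map_sum,
    Finset.sum_congr rfl hval] at hker
  -- Step 4: unique factorisation kills every coefficient
  have hC0 := eq_zero_of_sum_rat_mul_log_prime_eq_zero hS
    (fun p => ∑ i, ((n i * e i p : ℤ) : ℚ) * c i) hker
  -- Step 5: every `p`-block vanishes by linearity in the coefficient
  refine (QuotientAddGroup.eq_zero_iff _).mp ?_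
  show QuotientAddGroup.mk' relations (∑ i, n i • of (L i)) = 0
  rw [hsum]
  exact Finset.sum_eq_zero fun p hp =>
    sum_zsmul_carrier_eq_zero hR p Finset.univ (fun i => n i * e i p) c (hC0 p hp)

end K1

end Dlog

end Summit.KontsevichZagierPeriods.HurwitzMicroSectors.NormalFormPrinciple.PiBox
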